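import Summits.HodgeConjecture.CorCM.Census.TwistGenerationDescent

/-!
# Nondegenerate reduction: the ODD HALF of every closing is KUBOTA NONDEGENERACY of the base type

COR-CM (cell `pub-hodgecm2`), count-neutral kernel combinatorics by the binder seat b09 (gen 38; lane TWO-ADIC SPLITTING +
NONDEGENERATE REDUCTION, part A), in seat b09ʼs intrinsic currency (`CMF G c`, `indG`, `typeSum`: `CorCM/Prior/AllgGroup1.lean`; `rt`,
`translates`: `Census/BlockParityLaw.lean`; `pair`, `pairSet`, `hodgeSpan`: `Census/CoinvariantFibre.lean`; `indG_rt`: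
`Census/TwistGenerationDescent.lean`) used BY NAME.  Theorems only: no definition, no `decide`, no certificate, no named fact, no `sorry`.
HONEST FRAMING: `HC_CM` is NOT proved, here or anywhere in the tree; nothing here is a period or a headline.

THE SETTING.  `G` a finite group, `c` a central involution, `ℤ[types] = CMF G c →₀ ℤ`, the Hodge lattice `hodgeSpan = ℤ⟨faces⟩ + ℤ⟨pairs⟩`
(= the vectors of constant type sum, `Coinvariant.mem_hodgeSpan_iff`), and the census question of every column of this directory: generate
`hodgeSpan` modulo the pairs by the base changes `[Ψ] ↦ [Ψ·Q⁻¹]` (`rt`) of few face relations.  Every column so far proceeds by COVERING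
(one face per block of potential `≥ 2` pushes every type down to the residual types near a base type `T₀`) and CLOSING (a handful of
relations among the residual types).  This file isolates what the closing has to achieve AWAY FROM THE PRIME `2`, for an ARBITRARY `(G, c)`
and an ARBITRARY base type `T₀`.

**THEOREM (`two_pow_smul_mem_of_reduction`, §3).**  Let `L` be a lattice with `ℤ⟨pairs⟩ ≤ L ≤ hodgeSpan`.  Suppose
* (COMPLETE REDUCTION up to `2^k`) every CM type `Φ` has `2^k·[Φ] ∈ L + ℤ⟨[T₀·Q⁻¹] : Q ∈ G⟩` — modulo `L`, every type is an integer
  combination of the base changes of the single type `T₀`;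
* (NONDEGENERACY of `T₀`) the only antisymmetric `f : G → ℤ` (`f(cQ) = −f(Q)`) with `Σ_Q f(Q)·1_{T₀}(xQ) = 0` for all `x` is `f = 0` —
  equivalently `Σ_{y ∈ T₀} y ∈ ℚ[G]` is invertible in the component `ℚ[G]·(1 − c)/2`, i.e. `ρ(Σ_{y∈T₀} y)` is invertible for every
  irreducible `ρ` with `ρ(c) = −1`: KUBOTAʼS NONDEGENERACY of the CM type `T₀` (maximal rank of the span of the translated indicators
  `x ↦ 1_{T₀}(xQ)`; for a Galois CM field, the Hodge ring of `A_{T₀}` is generated by divisor classes [Pohlmann1968, Thm 1]).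
Then **`2^k · hodgeSpan ≤ L`**.

PROOF.  For `y ∈ hodgeSpan` write `2^k y = ℓ + Σ_Q a_Q [T₀·Q⁻¹]`, `ℓ ∈ L`.  The sum lies in `hodgeSpan`, so its type sum
`x ↦ Σ_Q a_Q 1_{T₀}(xQ)` (`typeSum_sum_baseVec`, §1) is constant; hence the antisymmetrisation `f(Q) = a_Q − a_{cQ}` is killed by the
convolution (`conv_antisym_eq_zero`, §2), so `f = 0` by nondegeneracy: `a_Q = a_{cQ}`.  Summing over a transversal of `G/⟨c⟩` — a CM type IS
one (`sum_eq_sum_type_add`) — gives `Σ_Q a_Q [T₀·Q⁻¹] = Σ_{Q ∈ T₀} a_Q·pair(T₀·Q⁻¹) ∈ ℤ⟨pairs⟩ ≤ L` (`sum_baseVec_mem_span_pairSet`).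
No `ℤ[1/2]` and no representation theory enter: the power of `2` in the conclusion is exactly the power in the reduction hypothesis.

§4 **CERTIFICATE FORM OF NONDEGENERACY** (`nondegenerate_of_cert`): if `t, w : G → ℤ` and `j` satisfy
`Σ_x t(x)·1_{T₀}(x⁻¹g) = 2^j·[g = 1] + w(g) + w(cg)` for all `g` — `Σ_x t(x)x` is a quasi-inverse of `Σ_{y∈T₀} y` modulo the ideal
`(1 + c)` — then `T₀` is nondegenerate; this is the shape of seat b04ʼs kernel certificates (`CorCM/GaloisSixteen*Census.lean`,
`isNondegenerate_*`: every primitive type of the order-16 groups is nondegenerate).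
§5 packages the theorem for `L = ℤ⟨pairs⟩ + ℤ⟨base changes of S⟩` (`two_pow_smul_mem_psp_of_reduction`), the currency of seat b23ʼs
`Census/OddIndexGeneration.lean`, and for a reduction given in two stages (all types → residual types integrally, residual types → the base
block up to `2^k`: `reduction_of_residual`).  With `OddIndex.generate_of_odd_smul_of_two_pow_smul` and part B of this lane
(`Census/TwoAdicSplitting.lean`), `μ(G,c) = φ₂(G,c)` for a `2`-group follows from a complete reduction onto a nondegenerate base type.

## References
* [Pohlmann1968] H. Pohlmann, Algebraic cycles on abelian varieties of complex multiplication type, Ann. of Math. 88 (1968), Thm 1.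
-/

namespace Summit.HodgeConjecture.CorCM.Census.Nondegenerate

open Finset
open Summit.HodgeConjecture.CorCM.Prior.AllgGroup.RfwfAllgGroup
open Summit.HodgeConjecture.CorCM.Census.BlockParity
open Summit.HodgeConjecture.CorCM.Census.Coinvariant
open Summit.HodgeConjecture.CorCM.Census.TwistGeneration

noncomputable section

variable {G : Type*} [Group G] [Fintype G] [DecidableEq G] (c : G)

/-! ## §1 Base changes of `T₀`: type sums, and a CM type as a transversal of `G/⟨c⟩` -/

/-- **Type sum of a combination of base changes of `T₀`**: `typeSum (Σ_Q a_Q [T₀·Q⁻¹]) (x) = Σ_Q a_Q·1_{T₀}(xQ)`. [folklore] -/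
theorem typeSum_sum_baseVec (T₀ : CMF G c) (a : G → ℤ) (x : G) :
    typeSum G c (∑ Q, a Q • Finsupp.single (rt c Q T₀) (1 : ℤ)) x = ∑ Q, a Q * indG T₀.1 (x * Q) := by
  rw [map_sum, Finset.sum_apply]
  refine Finset.sum_congr rfl fun Q _ => ?_
  rw [map_smul, Pi.smul_apply, typeSum_single, smul_eq_mul, indG_rt]

/-- **A CM type is a transversal of `G/⟨c⟩`**: `Σ_{Q ∈ G} h(Q) = Σ_{Q ∈ T₁} h(Q) + Σ_{Q ∈ T₁} h(cQ)`. [folklore] -/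
theorem sum_eq_sum_type_add (hc2 : c * c = 1) (T₁ : CMF G c) {M : Type*} [AddCommMonoid M] (h : G → M) :
    ∑ Q, h Q = ∑ Q ∈ T₁.1, h Q + ∑ Q ∈ T₁.1, h (c * Q) := by
  have hcc : ∀ x : G, c * (c * x) = x := fun x => by rw [← mul_assoc, hc2, one_mul]
  have hcompl : univ \ T₁.1 = T₁.1.image (fun Q => c * Q) := by
    ext x
    simp only [mem_sdiff, mem_univ, true_and, mem_image]
    constructor
    · intro hx
      refine ⟨c * x, ?_, hcc x⟩
      by_contra h
      exact hx ((T₁.2 x).mpr h)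
    · rintro ⟨Q, hQ, rfl⟩
      exact (T₁.2 Q).mp hQ
  have hinj : Set.InjOn (fun Q => c * Q) ↑T₁.1 := fun x _ y _ (hxy : c * x = c * y) => mul_left_cancel hxy
  rw [← Finset.sum_sdiff (subset_univ T₁.1), hcompl, Finset.sum_image hinj, add_comm]

omit [DecidableEq G] in
/-- **Reindexing along `c`**: `Σ_Q h(cQ) = Σ_Q h(Q)`. [folklore] -/
theorem sum_cmul_eq {M : Type*} [AddCommMonoid M] (h : G → M) : ∑ Q, h (c * Q) = ∑ Q, h Q :=
  Fintype.sum_equiv (Equiv.mulLeft c) _ _ fun _ => rfl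

/-! ## §2 Antisymmetrisation of a Hodge combination of base changes -/

/-- **The convolution kills the antisymmetrisation.**  If `Σ_Q a_Q [T₀·Q⁻¹]` has constant type sum then `f(Q) = a_Q − a_{cQ}` has
`Σ_Q f(Q)·1_{T₀}(xQ) = 0` for every `x` (the type sums at `x` and at `xc` cancel). [folklore] -/
theorem conv_antisym_eq_zero (hc2 : c * c = 1) (T₀ : CMF G c) (a : G → ℤ) {k : ℤ}
    (hk : ∀ x, typeSum G c (∑ Q, a Q • Finsupp.single (rt c Q T₀) (1 : ℤ)) x = k) (x : G) :
    ∑ Q, (a Q - a (c * Q)) * indG T₀.1 (x * Q) = 0 := by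
  have h1 := hk x
  have h2 := hk (x * c)
  rw [typeSum_sum_baseVec] at h1 h2
  have h3 : ∑ Q, a (c * Q) * indG T₀.1 (x * Q) = ∑ Q, a Q * indG T₀.1 (x * c * Q) := by
    rw [← sum_cmul_eq c (fun Q => a Q * indG T₀.1 (x * c * Q))]
    refine Finset.sum_congr rfl fun Q _ => ?_
    show a (c * Q) * indG T₀.1 (x * Q) = a (c * Q) * indG T₀.1 (x * c * (c * Q))
    rw [mul_assoc x c (c * Q), ← mul_assoc c c Q, hc2, one_mul]
  simp only [sub_mul, Finset.sum_sub_distrib, h1, h3, h2, sub_self]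

omit [Fintype G] [DecidableEq G] in
/-- The antisymmetrisation `Q ↦ a_Q − a_{cQ}` is antisymmetric. [folklore] -/
theorem antisym_cmul (hc2 : c * c = 1) (a : G → ℤ) (Q : G) : a (c * Q) - a (c * (c * Q)) = -(a Q - a (c * Q)) := by
  rw [← mul_assoc, hc2, one_mul]; ring

/-- **A combination of base changes of `T₀` with `c`-symmetric coefficients is a sum of pairs**:
`a_Q = a_{cQ}` for all `Q` gives `Σ_Q a_Q [T₀·Q⁻¹] = Σ_{Q ∈ T₀} a_Q · pair(T₀·Q⁻¹) ∈ ℤ⟨pairs⟩`. [folklore] -/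
theorem sum_baseVec_mem_span_pairSet (hc2 : c * c = 1) (T₀ : CMF G c) (a : G → ℤ) (ha : ∀ Q, a Q = a (c * Q)) :
    (∑ Q, a Q • Finsupp.single (rt c Q T₀) (1 : ℤ)) ∈ Submodule.span ℤ (pairSet c) := by
  rw [sum_eq_sum_type_add c hc2 T₀ (fun Q => a Q • Finsupp.single (rt c Q T₀) (1 : ℤ)), ← Finset.sum_add_distrib]
  refine Submodule.sum_mem _ fun Q _ => ?_
  have e : a Q • Finsupp.single (rt c Q T₀) (1 : ℤ) + a (c * Q) • Finsupp.single (rt c (c * Q) T₀) (1 : ℤ) =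
      a Q • pair c (rt c Q T₀) := by
    rw [← ha Q, rt_mul, pair, smul_add]
  rw [e]
  exact Submodule.smul_mem _ _ (Submodule.subset_span (pair_mem_pairSet c _))

/-- **A Hodge combination of base changes of a NONDEGENERATE type is a sum of pairs.** [folklore] -/
theorem sum_baseVec_mem_span_pairSet_of_mem_hodgeSpan (hc2 : c * c = 1) (hcen : ∀ x : G, x * c = c * x) (T₀ : CMF G c)
    (hT₀ : ∀ f : G → ℤ, (∀ Q, f (c * Q) = -f Q) → (∀ x, ∑ Q, f Q * indG T₀.1 (x * Q) = 0) → ∀ Q, f Q = 0)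
    (a : G → ℤ) (ha : (∑ Q, a Q • Finsupp.single (rt c Q T₀) (1 : ℤ)) ∈ hodgeSpan c hc2) :
    (∑ Q, a Q • Finsupp.single (rt c Q T₀) (1 : ℤ)) ∈ Submodule.span ℤ (pairSet c) := by
  obtain ⟨k, hk⟩ := exists_forall_typeSum_eq_of_mem_hodgeSpan c hc2 hcen ha
  have hf := hT₀ (fun Q => a Q - a (c * Q)) (fun Q => antisym_cmul c hc2 a Q) (conv_antisym_eq_zero c hc2 T₀ a hk)
  exact sum_baseVec_mem_span_pairSet c hc2 T₀ a fun Q => sub_eq_zero.mp (hf Q)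

/-! ## §3 THE THEOREM: complete reduction onto a nondegenerate base type generates up to the same power of `2` -/

/-- Every vector reduces when every type does: `2^k·y ∈ L + ℤ⟨base changes of T₀⟩` for all `y`. [folklore] -/
theorem two_pow_smul_mem_sup_of_forall_single (T₀ : CMF G c) (L : Submodule ℤ (CMF G c →₀ ℤ)) (k : ℕ)
    (hred : ∀ Φ : CMF G c, ((2 : ℤ) ^ k) • Finsupp.single Φ (1 : ℤ) ∈
      L ⊔ Submodule.span ℤ (Set.range fun Q : G => Finsupp.single (rt c Q T₀) (1 : ℤ)))
    (y : CMF G c →₀ ℤ) :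
    ((2 : ℤ) ^ k) • y ∈ L ⊔ Submodule.span ℤ (Set.range fun Q : G => Finsupp.single (rt c Q T₀) (1 : ℤ)) := by
  induction y using Finsupp.induction_linear with
  | zero => rw [smul_zero]; exact Submodule.zero_mem _
  | add y z hy hz => rw [smul_add]; exact Submodule.add_mem _ hy hz
  | single Φ n =>
    rw [← Finsupp.smul_single_one Φ n, smul_comm]
    exact Submodule.smul_mem _ n (hred Φ)

/-- **THEOREM (nondegenerate reduction).**  `ℤ⟨pairs⟩ ≤ L ≤ hodgeSpan`, every type reduces to the base changes of `T₀` modulo `L` up to `2^k`,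
and `T₀` is nondegenerate `⟹ 2^k · hodgeSpan ≤ L`. [folklore] -/
theorem two_pow_smul_mem_of_reduction (hc2 : c * c = 1) (hcen : ∀ x : G, x * c = c * x) (T₀ : CMF G c)
    (hT₀ : ∀ f : G → ℤ, (∀ Q, f (c * Q) = -f Q) → (∀ x, ∑ Q, f Q * indG T₀.1 (x * Q) = 0) → ∀ Q, f Q = 0)
    (L : Submodule ℤ (CMF G c →₀ ℤ)) (hPL : Submodule.span ℤ (pairSet c) ≤ L) (hLH : L ≤ hodgeSpan c hc2) (k : ℕ)
    (hred : ∀ Φ : CMF G c, ((2 : ℤ) ^ k) • Finsupp.single Φ (1 : ℤ) ∈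
      L ⊔ Submodule.span ℤ (Set.range fun Q : G => Finsupp.single (rt c Q T₀) (1 : ℤ)))
    {y : CMF G c →₀ ℤ} (hy : y ∈ hodgeSpan c hc2) : ((2 : ℤ) ^ k) • y ∈ L := by
  obtain ⟨l, hl, b, hb, hsum⟩ := Submodule.mem_sup.mp (two_pow_smul_mem_sup_of_forall_single c T₀ L k hred y)
  obtain ⟨a, rfl⟩ := (Submodule.mem_span_range_iff_exists_fun ℤ).mp hb
  have hbH : (∑ Q, a Q • Finsupp.single (rt c Q T₀) (1 : ℤ)) ∈ hodgeSpan c hc2 := by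
    have e : (∑ Q, a Q • Finsupp.single (rt c Q T₀) (1 : ℤ)) = ((2 : ℤ) ^ k) • y - l := by rw [← hsum]; abel
    rw [e]
    exact Submodule.sub_mem _ (Submodule.smul_mem _ _ hy) (hLH hl)
  rw [← hsum]
  exact Submodule.add_mem _ hl (hPL (sum_baseVec_mem_span_pairSet_of_mem_hodgeSpan c hc2 hcen T₀ hT₀ a hbH))

/-! ## §4 The certificate form of nondegeneracy (a quasi-inverse modulo `1 + c`) -/

/-- **Nondegeneracy from a quasi-inverse.**  If `Σ_x t(x)·1_{T₀}(x⁻¹g) = 2^j·[g = 1] + w(g) + w(cg)` for all `g`, then every antisymmetric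
`f` killed by the convolution with `1_{T₀}` vanishes (apply the quasi-inverse to `Σ_Q f(Q) 1_{T₀}(gQ) = 0`: the `w`-terms cancel by
antisymmetry and `2^j f` remains). [folklore] -/
theorem nondegenerate_of_cert (hc2 : c * c = 1) (hcen : ∀ x : G, x * c = c * x) (T₀ : CMF G c) (t w : G → ℤ) (j : ℕ)
    (hcert : ∀ g : G, ∑ x, t x * indG T₀.1 (x⁻¹ * g) = (if g = 1 then (2 : ℤ) ^ j else 0) + w g + w (c * g)) :
    ∀ f : G → ℤ, (∀ Q, f (c * Q) = -f Q) → (∀ x, ∑ Q, f Q * indG T₀.1 (x * Q) = 0) → ∀ Q, f Q = 0 := by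
  intro f hanti hconv R
  -- the quasi-inverse applied to the vanishing convolution
  have hS : ∑ g, t (R⁻¹ * g⁻¹) * (∑ Q, f Q * indG T₀.1 (g * Q)) = 0 := by
    simp only [hconv, mul_zero, Finset.sum_const_zero]
  -- swap the sums and evaluate the inner one by the certificate
  have hswap : ∑ g, t (R⁻¹ * g⁻¹) * (∑ Q, f Q * indG T₀.1 (g * Q)) =
      ∑ Q, f Q * ((if R⁻¹ * Q = 1 then (2 : ℤ) ^ j else 0) + w (R⁻¹ * Q) + w (c * (R⁻¹ * Q))) := by
    simp only [Finset.mul_sum]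
    rw [Finset.sum_comm]
    refine Finset.sum_congr rfl fun Q _ => ?_
    have hin : ∑ g, t (R⁻¹ * g⁻¹) * (f Q * indG T₀.1 (g * Q)) = f Q * ∑ x, t x * indG T₀.1 (x⁻¹ * (R⁻¹ * Q)) := by
      rw [Finset.mul_sum]
      refine Fintype.sum_equiv ((Equiv.inv G).trans (Equiv.mulLeft R⁻¹)) _ _ fun g => ?_
      simp only [Equiv.trans_apply, Equiv.inv_apply, Equiv.coe_mulLeft, mul_inv_rev, inv_inv]
      rw [show g * R * (R⁻¹ * Q) = g * Q by group]
      ring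
    rw [hin, hcert (R⁻¹ * Q)]
  rw [hswap] at hS
  -- the three pieces
  have hδ : ∑ Q, f Q * (if R⁻¹ * Q = 1 then (2 : ℤ) ^ j else 0) = (2 : ℤ) ^ j * f R := by
    have e : ∀ Q, (f Q * if R⁻¹ * Q = 1 then (2 : ℤ) ^ j else 0) = if Q = R then (2 : ℤ) ^ j * f R else 0 := by
      intro Q
      by_cases hQ : Q = R
      · subst hQ; rw [if_pos (inv_mul_cancel Q), if_pos rfl, mul_comm]
      · rw [if_neg (fun h => hQ (inv_mul_eq_one.mp h).symm), if_neg hQ, mul_zero]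
    simp only [e, Finset.sum_ite_eq', mem_univ, if_true]
  have hw : ∑ Q, f Q * w (c * (R⁻¹ * Q)) = -∑ Q, f Q * w (R⁻¹ * Q) := by
    rw [← sum_cmul_eq c (fun Q => f Q * w (c * (R⁻¹ * Q))), ← Finset.sum_neg_distrib]
    refine Finset.sum_congr rfl fun Q _ => ?_
    show f (c * Q) * w (c * (R⁻¹ * (c * Q))) = -(f Q * w (R⁻¹ * Q))
    have e : c * (R⁻¹ * (c * Q)) = R⁻¹ * Q := by
      rw [← mul_assoc, ← hcen R⁻¹, mul_assoc, ← mul_assoc c c Q, hc2, one_mul]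
    rw [hanti, e, neg_mul]
  have htot : (2 : ℤ) ^ j * f R = 0 := by
    have e : ∑ Q, f Q * ((if R⁻¹ * Q = 1 then (2 : ℤ) ^ j else 0) + w (R⁻¹ * Q) + w (c * (R⁻¹ * Q))) =
        ∑ Q, f Q * (if R⁻¹ * Q = 1 then (2 : ℤ) ^ j else 0) + ∑ Q, f Q * w (R⁻¹ * Q) + ∑ Q, f Q * w (c * (R⁻¹ * Q)) := by
      simp only [mul_add, Finset.sum_add_distrib]
    rw [e, hδ, hw] at hS
    linarith
  exact (mul_eq_zero.mp htot).resolve_left (pow_ne_zero j two_ne_zero)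

/-! ## §5 Packaged forms: `L = ℤ⟨pairs⟩ + ℤ⟨base changes of S⟩`; two-stage reductions -/

/-- **Two-stage reduction.**  If every type reduces INTEGRALLY to a residual set of types modulo `L`, and every residual type reduces to the
base changes of `T₀` up to `2^k` modulo `L`, then every type reduces up to `2^k`. [folklore] -/
theorem reduction_of_residual (T₀ : CMF G c) (L : Submodule ℤ (CMF G c →₀ ℤ)) (Res : Set (CMF G c)) (k : ℕ)
    (hcov : ∀ Φ : CMF G c, Finsupp.single Φ (1 : ℤ) ∈ L ⊔ Submodule.span ℤ ((fun Ψ => Finsupp.single Ψ (1 : ℤ)) '' Res))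
    (hres : ∀ Ψ ∈ Res, ((2 : ℤ) ^ k) • Finsupp.single Ψ (1 : ℤ) ∈
      L ⊔ Submodule.span ℤ (Set.range fun Q : G => Finsupp.single (rt c Q T₀) (1 : ℤ))) (Φ : CMF G c) :
    ((2 : ℤ) ^ k) • Finsupp.single Φ (1 : ℤ) ∈ L ⊔ Submodule.span ℤ (Set.range fun Q : G => Finsupp.single (rt c Q T₀) (1 : ℤ)) := by
  obtain ⟨l, hl, r, hr, hsum⟩ := Submodule.mem_sup.mp (hcov Φ)
  rw [← hsum, smul_add]
  refine Submodule.add_mem _ (Submodule.mem_sup_left (Submodule.smul_mem _ _ hl)) ?_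
  have hle : Submodule.span ℤ ((fun Ψ => Finsupp.single Ψ (1 : ℤ)) '' Res) ≤
      Submodule.comap (LinearMap.lsmul ℤ (CMF G c →₀ ℤ) ((2 : ℤ) ^ k))
        (L ⊔ Submodule.span ℤ (Set.range fun Q : G => Finsupp.single (rt c Q T₀) (1 : ℤ))) := by
    rw [Submodule.span_le]
    rintro _ ⟨Ψ, hΨ, rfl⟩
    exact hres Ψ hΨ
  exact hle hr

/-- **Packaged: reduction onto a nondegenerate base type modulo `ℤ⟨pairs⟩ + ℤ⟨base changes of S⟩` generates up to `2^k`** — the hypothesis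
shape of seat b23ʼs `OddIndex.generate_of_odd_smul_of_two_pow_smul`. [folklore] -/
theorem two_pow_smul_mem_psp_of_reduction (hc2 : c * c = 1) (hcen : ∀ x : G, x * c = c * x) (T₀ : CMF G c)
    (hT₀ : ∀ f : G → ℤ, (∀ Q, f (c * Q) = -f Q) → (∀ x, ∑ Q, f Q * indG T₀.1 (x * Q) = 0) → ∀ Q, f Q = 0)
    (S : Finset (CMF G c →₀ ℤ)) (hS : (↑S : Set (CMF G c →₀ ℤ)) ⊆ hodgeSpan c hc2) (k : ℕ)
    (hred : ∀ Φ : CMF G c, ((2 : ℤ) ^ k) • Finsupp.single Φ (1 : ℤ) ∈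
      (Submodule.span ℤ (pairSet c) ⊔ Submodule.span ℤ (translates c S)) ⊔
        Submodule.span ℤ (Set.range fun Q : G => Finsupp.single (rt c Q T₀) (1 : ℤ))) :
    ∀ y ∈ hodgeSpan c hc2, ((2 : ℤ) ^ k) • y ∈ Submodule.span ℤ (pairSet c) ⊔ Submodule.span ℤ (translates c S) := by
  intro y hy
  refine two_pow_smul_mem_of_reduction c hc2 hcen T₀ hT₀ _ le_sup_left ?_ k hred hy
  refine sup_le (Submodule.span_le.mpr fun _ ⟨Ψ, h⟩ => h ▸ pair_mem_hodgeSpan c hc2 Ψ) (Submodule.span_le.mpr ?_)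
  rintro _ ⟨Q, s, hs, rfl⟩
  exact mapDomain_rt_mem_hodgeSpan c hc2 hcen Q (hS (Finset.mem_coe.mpr hs))

end

end Summit.HodgeConjecture.CorCM.Census.Nondegenerate
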